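import Summits.BirchSwinnertonDyer.BirchSwinnertonDyer.Theorems.PrintCf2RubinValueTwoLinePinExponentPinGeneral
import Summits.BirchSwinnertonDyer.BirchSwinnertonDyer.Theorems.PrintCf2RubinValueTwoLinePinDefectOddClass
import Summits.BirchSwinnertonDyer.BirchSwinnertonDyer.Theorems.SignedBaseChangeAnticyclotomicEisensteinDivisibilityFinitePieceDescent
import HarnessLib

/-!
# M-LINE-PIN, part 9: THE CLASS JUNCTION WITH EVERY ALGEBRAIC SIDE CONDITION DISCHARGED —
# `[Finite g.ker]` from Müller's own hypothesis «`θ` non-trivial on `ker κ₁`», `[Module.Finite Λ₂ D₂.X]`, `(ch)(T₁,0) ≠ 0`, the control `g, φ, πC` eliminated: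
# (Q) + (M) + (A) + S3n′ + even class ⟹ `D₂.X` torsion ∧ `a = b` ∧ `(ch_{Λ₂} D₂.X)^J = (G₂)`

Cell `bsd-print-cf2`, width seat `bsd-line-cf2c-w8` g4 (prover-bsd-line-cf2c-w8-g4-0), planner g19's named piece M-LINE-PIN (crux child
stmt-BirchSwinnertonDyer-24086 `MainConjClauseAtSplitTwoQuad`; skeleton SPEC `M-LINE-PIN-SKELETON-SPEC-g19.md`). Composition of parts 7–8b with (C1)
(`LinePinControl.exists_lineRes_unr`, `exists_transpose_unr`, `finite_ker_lineRes_unr`), (F2-fg) `TwoVarDualFinite.module_finite_dualData₂_charModule`, cf2c-w2 g4's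
`LinePinDefect.finite_setOf_fixed_charModule_two`, and the density theorem `SignedBaseChangeAcDivFinitePiece.eq_top_of_isOpen_of_subgroupOf_pairKer_le`
(`pairKer` and `γ₂` topologically generate `ker κ₁`). NEW INPUT DISCHARGED HERE: the finite kernel of the slot-1 control, from Müller's hypothesis
`∃ σ ∈ ker κ₁, θ σ ≠ 1` — either `θ` moves something in `pairKer` (then `A_θ^{pairKer} ⊆ A_θ[2]` is finite) or `θ` is trivial on `pairKer` and then
`θ(γ₂) = −1` (density), so `γ₂ − 1 = −2` is ONTO the `2`-divisible `A_θ = A_θ^{pairKer}`; in both cases `A_θ^{pairKer} ⧸ (γ₂ − 1)` is finite and (C1) applies.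
`--supports stmt-BirchSwinnertonDyer-24086 --as helper`, Theses-free. HONEST FRAMING: assembly; the displayed inputs of the final statement are EXACTLY:
(Q) `hQ` (⊗ℚ-form of the two-variable main conjecture for a generator `F` of `ch_{Λ₂} D₂.X`), (M) `hD₁` + `hM` + `hG₁` (Müller 2020 Thm 1.3 in the typed shape
`Muller2020.thm13_exists_nuBranch_charIdeal_eq.exists_span_eq` / `.finite_and_isTorsion`, with its hypothesis `hθκ`), (A) `hA` (`(G₂(T₁,0)) = ((1+T) − u)^e · (G₁)`
for a Frobenius lift `τ ∈ D_v̄` with `κ₁ τ = κ₁ γ₁` acting on `A_θ` as `u`, `2 ∣ u − 1` — parts 5/6 produce such `τ, u = ±1` on the `ℚ(√−7)` frame), S3n′ `hfin`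
(item 24037), the even local class `hI`, and `κ₂` unramified outside `v̄ ∣ 2`. No summit statement is proved by this seat; BSD is not proved by any of this.
THEOREMS ONLY (no definition, no named fact, no `sorry`).

* `unitChar_eq_one_of_apply_eq_one` — `θ σ = 1 ⟹ unitChar θ σ = 1`.
* `unitChar_apply_ne_one_of_forall_pairKer` — `θ` trivial on `pairKer κ₁ κ₂`, non-trivial on `ker κ₁` ⟹ `unitChar θ γ₂ ≠ 1` (density).
* `finite_fixedPoints_pairKer_quotient_of_exists_apply_ne_one` — `A_θ^{pairKer} ⧸ (γ₂ − 1) A_θ^{pairKer}` is finite (`p = 2`, `θ² = 1`, `θ` non-trivial on `ker κ₁`).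
* `finite_ker_lineRes_unr_charModule` — the slot-1 control `g : H¹_nr(K_∞^{(1)}, A_θ) → H¹_nr(K̃_∞, A_θ)` has finite kernel.
* `isTorsion_and_eq_and_map_charIdeal_eq_span_of_powForm_charModule` — THE CLASS JUNCTION (any number field `K`, `p = 2`);
  `…_of_mem_decomp` — the Frobenius-adapted form (`τ := γ₁ ∈ D_v̄`).
presearch: Greenberg LNM 1716 §3 L. 3.1–3.2 (finite kernel of restriction), Washington §13.1 (density in `ℤ_p`) — tree theorems; assembly. beyond-print theorem: no.

References: [GreenbergLNM1716] §3–4; [GreenbergVatsal2000] §2; [Washington1997] §13.1–13.2; [deShalit1987] II.4.12; [Mueller2020MCSplitTwo] Thm. 1.3;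
[KellerYin2024] §1.1.
-/

noncomputable section

open scoped Classical Pointwise AddSubgroup NumberField

-- the summit namespace `Summit.BirchSwinnertonDyer.BirchSwinnertonDyer` repeats the problem name by design (D-0017)
set_option linter.dupNamespace false
set_option autoImplicit false

open NumberField IsDedekindDomain Field Literature.NumberTheory.GaloisRepresentations
  Literature.NumberTheory.EllipticCurves Literature.NumberTheory.EllipticCurves.Module
  Literature.NumberTheory.EllipticCurves.IwasawaAlgebra Literature.NumberTheory.EllipticCurves.GreenbergSelmer
  Literature.NumberTheory.EllipticCurves.GreenbergVatsal2000 Literature.NumberTheory.EllipticCurves.KellerYin2024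
  Literature.NumberTheory.EllipticCurves.IwasawaDual
open Summit.BirchSwinnertonDyer.BirchSwinnertonDyer.Theorems.PrintCf2

namespace Summit.BirchSwinnertonDyer.BirchSwinnertonDyer.Theorems.PrintCf2.LinePin

variable {K : Type} [Field K] [NumberField K]

/-! ## §1. `A_θ^{pairKer} ⧸ (γ₂ − 1)` is finite when `θ` is non-trivial on `ker κ₁` -/

section KernelFinite

variable {p : ℕ} [Fact p.Prime]

omit [NumberField K] in
/-- `θ σ = 1 ⟹ unitChar θ σ = 1` (`unitChar` is `det θ` read in `ℤ_pˣ`). [cite: KellerYin2024, §1.1 (arXiv:2402.12781v2 TeX L441–449)] -/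
theorem unitChar_eq_one_of_apply_eq_one (θ : FramedGaloisRep K (padicCoeffIntegers (∅ : Set (PadicAlgCl p))) 1)
    {σ : absoluteGaloisGroup K} (hσ : θ σ = 1) : unitChar θ σ = 1 := by
  change (Units.map (padicIntEquivCoeffIntegersEmpty p).symm.toRingHom.toMonoidHom) (Matrix.GeneralLinearGroup.det (θ σ)) = 1
  rw [hσ, map_one, map_one]

omit [NumberField K] in
/-- **Density: `θ` trivial on `pairKer κ₁ κ₂` but non-trivial on `ker κ₁` forces `θ(γ₂) ≠ 1`.** The open subgroup `ker θ ∩ ker κ₁` of `ker κ₁` contains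
`pairKer`; if it also contained `γ₂` it would be all of `ker κ₁` (`pairKer` and `γ₂` topologically generate `ker κ₁`). [cite: Washington1997, §13.1] -/
theorem unitChar_apply_ne_one_of_forall_pairKer {κ₁ κ₂ : ZpExtension K p} {γ₁ γ₂ : absoluteGaloisGroup K}
    (hγ : ZpExtension.IsTopGeneratorPair κ₁ κ₂ γ₁ γ₂) (θ : FramedGaloisRep K (padicCoeffIntegers (∅ : Set (PadicAlgCl p))) 1)
    {n : ℕ} (hn : 0 < n) (hθn : ∀ σ : absoluteGaloisGroup K, θ σ ^ n = 1)
    (hθκ : ∃ σ ∈ κ₁.kerSubgroup, θ σ ≠ 1) (hA : ∀ σ ∈ ZpExtension.pairKer κ₁ κ₂, θ σ = 1) : unitChar θ γ₂ ≠ 1 := by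
  intro h1
  obtain ⟨σ, hσ, hσne⟩ := hθκ
  let H : Subgroup κ₁.kerSubgroup := ((unitChar θ).toMonoidHom.ker).subgroupOf κ₁.kerSubgroup
  have hH : IsOpen (H : Set κ₁.kerSubgroup) := (isOpen_ker_unitChar_of_pow_eq_one θ hn hθn).preimage continuous_subtype_val
  have hN : (ZpExtension.pairKer κ₁ κ₂).subgroupOf κ₁.kerSubgroup ≤ H := by
    intro x hx
    rw [Subgroup.mem_subgroupOf] at hx ⊢
    exact (MonoidHom.mem_ker).mpr (unitChar_eq_one_of_apply_eq_one θ (hA _ hx))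
  have hγH : (⟨γ₂, SignedBaseChangeAcDivFinitePiece.mem_kerSubgroup_of_pair hγ⟩ : κ₁.kerSubgroup) ∈ H := by
    rw [Subgroup.mem_subgroupOf]
    exact (MonoidHom.mem_ker).mpr h1
  have htop := SignedBaseChangeAcDivFinitePiece.eq_top_of_isOpen_of_subgroupOf_pairKer_le hγ H hH hN hγH
  have hσH : (⟨σ, hσ⟩ : κ₁.kerSubgroup) ∈ H := by rw [htop]; exact Subgroup.mem_top _
  rw [Subgroup.mem_subgroupOf, MonoidHom.mem_ker] at hσH
  exact CharLocalInertiaBounds.unitChar_ne_one_of_apply_ne_one θ hσne hσH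

omit [NumberField K] in
/-- **`A_θ^{pairKer κ₁ κ₂} ⧸ (γ₂ − 1)` IS FINITE** (`p = 2`, `θ² = 1`, `θ` non-trivial on `ker κ₁` — Müller's hypothesis): either `θ` moves an element of
`pairKer` (then `A_θ^{pairKer} ⊆ A_θ[2]`, finite) or `θ|_{pairKer} = 1` and `θ(γ₂) = −1` (density), so `γ₂ − 1 = −2` is onto `A_θ^{pairKer} = A_θ`
(`2`-divisible) and the quotient is trivial. This is the hypothesis of (C1) `LinePinControl.finite_ker_lineRes_unr`. [cite: GreenbergLNM1716, §3 Lemma 3.1]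
[cite: Washington1997, §13.1] -/
theorem finite_fixedPoints_pairKer_quotient_of_exists_apply_ne_one {κ₁ κ₂ : ZpExtension K 2} {γ₁ γ₂ : absoluteGaloisGroup K}
    (hγ : ZpExtension.IsTopGeneratorPair κ₁ κ₂ γ₁ γ₂) (θ : FramedGaloisRep K (padicCoeffIntegers (∅ : Set (PadicAlgCl 2))) 1)
    (hθ2 : ∀ σ : absoluteGaloisGroup K, θ σ ^ 2 = 1) (hθκ : ∃ σ ∈ κ₁.kerSubgroup, θ σ ≠ 1) :
    Finite (FixedPoints.addSubgroup (ZpExtension.pairKer κ₁ κ₂) (charModule (∅ : Set (PadicAlgCl 2)) θ) ⧸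
      (ResKernel.subOne (ZpExtension.pairKer κ₁ κ₂) (charModule (∅ : Set (PadicAlgCl 2)) θ) γ₂).range) := by
  by_cases hA : ∃ σ ∈ ZpExtension.pairKer κ₁ κ₂, θ σ ≠ 1
  · -- the fixed points are finite
    obtain ⟨σ₀, hσ₀, hne⟩ := hA
    have hfin := LinePinDefect.finite_setOf_fixed_charModule_two θ hσ₀ (hθ2 σ₀) hne
    haveI := hfin.to_subtype
    haveI : Finite (FixedPoints.addSubgroup (ZpExtension.pairKer κ₁ κ₂) (charModule (∅ : Set (PadicAlgCl 2)) θ)) := by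
      refine Finite.of_injective
        (fun x : FixedPoints.addSubgroup (ZpExtension.pairKer κ₁ κ₂) (charModule (∅ : Set (PadicAlgCl 2)) θ) ↦
          (⟨(x : charModule (∅ : Set (PadicAlgCl 2)) θ), fun g hg ↦ (FixedPoints.mem_addSubgroup _ _ _).mp x.2 ⟨g, hg⟩⟩ :
            {m : charModule (∅ : Set (PadicAlgCl 2)) θ | ∀ g ∈ ZpExtension.pairKer κ₁ κ₂, g • m = m})) ?_
      intro x y hxy
      have h := congrArg Subtype.val hxy
      exact Subtype.ext h
    exact Finite.of_surjective _ (QuotientAddGroup.mk'_surjective _)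
  · push Not at hA
    have hγ₂ : unitChar θ γ₂ ≠ 1 := unitChar_apply_ne_one_of_forall_pairKer hγ θ two_pos hθ2 hθκ hA
    have hneg : ∀ a : charModule (∅ : Set (PadicAlgCl 2)) θ, γ₂ • a = -a := by
      rcases SignTransport.smul_charModule_eq_self_or_eq_neg_of_sq_eq_one θ (hθ2 γ₂) with ⟨h1, -⟩ | ⟨-, -, h⟩
      · exact absurd h1 hγ₂
      · exact h
    have htriv : ∀ σ ∈ ZpExtension.pairKer κ₁ κ₂, ∀ a : charModule (∅ : Set (PadicAlgCl 2)) θ, σ • a = a := by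
      intro σ hσ
      rcases SignTransport.smul_charModule_eq_self_or_eq_neg_of_sq_eq_one θ (hθ2 σ) with ⟨-, h⟩ | ⟨hne1, -, -⟩
      · exact h
      · exact absurd (unitChar_eq_one_of_apply_eq_one θ (hA σ hσ)) hne1
    have hsurj : Function.Surjective
        (ResKernel.subOne (ZpExtension.pairKer κ₁ κ₂) (charModule (∅ : Set (PadicAlgCl 2)) θ) γ₂) := by
      intro b
      obtain ⟨b', hb'⟩ := CharResidualSelmerCount.charModule_divisible θ (b : charModule (∅ : Set (PadicAlgCl 2)) θ)
      have hb'mem : b' ∈ FixedPoints.addSubgroup (ZpExtension.pairKer κ₁ κ₂) (charModule (∅ : Set (PadicAlgCl 2)) θ) :=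
        (FixedPoints.mem_addSubgroup _ _ _).mpr fun g ↦ htriv g g.2 b'
      refine ⟨-⟨b', hb'mem⟩, Subtype.ext ?_⟩
      rw [ResKernel.coe_subOne_apply, NegMemClass.coe_neg, smul_neg, hneg, neg_neg, sub_neg_eq_add, ← two_nsmul]
      exact hb'
    rw [AddMonoidHom.range_eq_top_of_surjective _ hsurj]
    infer_instance

/-- **THE SLOT-1 CONTROL HAS FINITE KERNEL on `A_θ`** (`p = 2`, `θ² = 1`, `θ` non-trivial on `ker κ₁`): (C1) `LinePinControl.finite_ker_lineRes_unr` with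
§1's finiteness. [cite: GreenbergLNM1716, §3 Lemmas 3.1–3.2] [cite: GreenbergVatsal2000, §2 p. 17] -/
theorem finite_ker_lineRes_unr_charModule {κ₁ κ₂ : ZpExtension K 2} {γ₁ γ₂ : absoluteGaloisGroup K}
    (hγ : ZpExtension.IsTopGeneratorPair κ₁ κ₂ γ₁ γ₂) (θ : FramedGaloisRep K (padicCoeffIntegers (∅ : Set (PadicAlgCl 2))) 1)
    (hθ2 : ∀ σ : absoluteGaloisGroup K, θ σ ^ 2 = 1) (hθκ : ∃ σ ∈ κ₁.kerSubgroup, θ σ ≠ 1) {vbar : HeightOneSpectrum (𝓞 K)}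
    {g : unrSelmer κ₁ (charModule (∅ : Set (PadicAlgCl 2)) θ) vbar ∅ →+ unrSelmer₂ κ₁ κ₂ (charModule (∅ : Set (PadicAlgCl 2)) θ) vbar}
    (hg : ∀ t : unrSelmer κ₁ (charModule (∅ : Set (PadicAlgCl 2)) θ) vbar ∅,
      ((g t : unrSelmer₂ κ₁ κ₂ (charModule (∅ : Set (PadicAlgCl 2)) θ) vbar) :
          subgroupH1 (ZpExtension.pairKer κ₁ κ₂) (charModule (∅ : Set (PadicAlgCl 2)) θ)) =
        resOfLe (charModule (∅ : Set (PadicAlgCl 2)) θ) (ZpExtension.pairKer_le_left κ₁ κ₂)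
          (t : subgroupH1 κ₁.kerSubgroup (charModule (∅ : Set (PadicAlgCl 2)) θ))) :
    Finite g.ker := by
  haveI := finite_fixedPoints_pairKer_quotient_of_exists_apply_ne_one hγ θ hθ2 hθκ
  exact LinePinControl.finite_ker_lineRes_unr hg hγ fun m ↦ CharResidualSelmerCount.continuous_smul_charModule θ m

end KernelFinite

/-! ## §2. The class junction: `g, φ, πC` eliminated, `[Module.Finite]`, `[Finite g.ker]`, `(ch)(T₁,0) ≠ 0`, torsion derived -/

section Junction

/-- **M-LINE-PIN, THE CLASS JUNCTION (any number field `K`, `p = 2`).** Data: `v̄ ∣ 2`; a generator pair `(κ₁, κ₂; γ₁, γ₂)` with `κ₂` unramified outside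
`v̄`; a QUADRATIC `θ` (`θ² = 1`) NON-TRIVIAL on `ker κ₁` ((M)'s hypothesis) with `pairKer ⊓ I_v̄` trivial on `A_θ` (even local class); a Frobenius lift
`τ ∈ D_v̄` UNDECOMPOSED in the line (`κ₁ τ = κ₁ γ₁`) acting on `A_θ` as the integer `u`, `2 ∣ u − 1`; a two-variable datum `D₂` with S3n′ (`hfin`) and a
generator `F` of `ch_{Λ₂} D₂.X`; a Greenberg–Vatsal datum `D₁` on the line with `D₁.X` TORSION and `(ch_Λ D₁.X)^J = (G₁)`, `G₁ ≠ 0` ((M), Müller 2020);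
the ⊗ℚ-form `(2^a F^J) = (2^b G₂)` ((Q)); `(G₂(T₁,0)) = ((1+T) − u)^e · (G₁)` ((A)). THEN: **`D₂.X` is `Λ₂`-torsion, `a = b`, and
`(ch_{Λ₂} D₂.X).map (map (map J)) = (G₂)`** — the clause of `MainConjClauseAtSplitTwoQuad` for this datum. Everything about the slot-1 control
(existence, transpose, finite kernel, cokernel presentation, `corank = e`) is INTERNAL. [cite: GreenbergVatsal2000, §2 Prop. (2.4)] [cite: GreenbergLNM1716, §3–4]
[cite: Washington1997, §13.2] [cite: deShalit1987, II.4.12] [cite: Mueller2020MCSplitTwo, Thm. 1.3] -/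
theorem isTorsion_and_eq_and_map_charIdeal_eq_span_of_powForm_charModule
    {vbar : HeightOneSpectrum (𝓞 K)} (hvbar : ((2 : ℕ) : 𝓞 K) ∈ vbar.asIdeal)
    {κ₁ κ₂ : ZpExtension K 2} (hκ₂ : κ₂.IsUnramifiedOutside vbar)
    {γ₁ γ₂ : absoluteGaloisGroup K} (hγ : ZpExtension.IsTopGeneratorPair κ₁ κ₂ γ₁ γ₂)
    (θ : FramedGaloisRep K (padicCoeffIntegers (∅ : Set (PadicAlgCl 2))) 1) (hθ2 : ∀ σ : absoluteGaloisGroup K, θ σ ^ 2 = 1)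
    (hθκ : ∃ σ ∈ κ₁.kerSubgroup, θ σ ≠ 1)
    (hI : ∀ y : absoluteGaloisGroup K, y ∈ ZpExtension.pairKer κ₁ κ₂ → y ∈ inertia vbar →
      ∀ m : charModule (∅ : Set (PadicAlgCl 2)) θ, y • m = m)
    {τ : absoluteGaloisGroup K} (hτ : τ ∈ decomp vbar) (hκτ : κ₁ τ = κ₁ γ₁) {u : ℤ}
    (hu : ∀ m : charModule (∅ : Set (PadicAlgCl 2)) θ, τ • m = u • m) (hpu : (2 : ℤ) ∣ u - 1)
    (D₂ : DualData₂ κ₁ κ₂ (charModule (∅ : Set (PadicAlgCl 2)) θ) vbar γ₁ γ₂)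
    (hfin : ∀ N : Submodule (IwasawaAlgebra₂ 2) D₂.X, Module.IsPseudoNull (IwasawaAlgebra₂ 2) N → Finite N)
    (D₁ : DatumDualData κ₁ γ₁ (charModule (∅ : Set (PadicAlgCl 2)) θ)
      (Castella2018.AcSelmer.bdpData (charModule (∅ : Set (PadicAlgCl 2)) θ) 2 vbar) ∅)
    (hD₁ : Module.IsTorsion (IwasawaAlgebra 2) D₁.X)
    (J : ℤ_[2] →+* PadicComplexInt 2) (G₁ : PowerSeries (PadicComplexInt 2)) (hG₁ : G₁ ≠ 0)
    (hM : (charIdeal (IwasawaAlgebra 2) D₁.X).map (PowerSeries.map J) = Ideal.span {G₁})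
    (G₂ : PowerSeries (PowerSeries (PadicComplexInt 2))) (F : IwasawaAlgebra₂ 2)
    (hF : charIdeal (IwasawaAlgebra₂ 2) D₂.X = Ideal.span {F})
    {a b : ℕ} (hQ : Ideal.span ({((2 : ℕ) : PowerSeries (PowerSeries (PadicComplexInt 2))) ^ a *
        PowerSeries.map (PowerSeries.map J) F} : Set (PowerSeries (PowerSeries (PadicComplexInt 2)))) =
      Ideal.span {((2 : ℕ) : PowerSeries (PowerSeries (PadicComplexInt 2))) ^ b * G₂})
    {e : ℕ} (hA : Ideal.span ({PowerSeries.map (PowerSeries.constantCoeff (R := PadicComplexInt 2)) G₂} : Set (PowerSeries (PadicComplexInt 2))) =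
      Ideal.span {((1 : PowerSeries (PadicComplexInt 2)) + PowerSeries.X) - (u : PowerSeries (PadicComplexInt 2))} ^ e *
        Ideal.span {G₁}) :
    Module.IsTorsion (IwasawaAlgebra₂ 2) D₂.X ∧ a = b ∧
      (charIdeal (IwasawaAlgebra₂ 2) D₂.X).map (PowerSeries.map (PowerSeries.map J)) = Ideal.span {G₂} := by
  -- side conditions of the character module
  have hcont : ∀ m : charModule (∅ : Set (PadicAlgCl 2)) θ, Continuous fun σ : absoluteGaloisGroup K ↦ σ • m :=
    fun m ↦ CharResidualSelmerCount.continuous_smul_charModule θ m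
  have hprim : ∀ m : charModule (∅ : Set (PadicAlgCl 2)) θ, ∃ k : ℕ, 2 ^ k • m = 0 :=
    fun m ↦ exists_pow_smul_cofree_eq_zero (∅ : Set (PadicAlgCl 2)) θ m
  have hstab : ∀ m : charModule (∅ : Set (PadicAlgCl 2)) θ,
      IsOpen (MulAction.stabilizer (absoluteGaloisGroup K) m : Set (absoluteGaloisGroup K)) :=
    fun m ↦ isOpen_stabilizer_cofree (∅ : Set (PadicAlgCl 2)) θ m
  haveI : Module.Finite (IwasawaAlgebra₂ 2) D₂.X :=
    TwoVarDualFinite.module_finite_dualData₂_charModule (κ₁ := κ₁) (κ₂ := κ₂) (vbar := vbar) θ hγ two_pos hθ2 D₂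
  -- the slot-1 control and its transpose ((C1)), with finite kernel (§1)
  obtain ⟨g, hg⟩ := LinePinControl.exists_lineRes_unr κ₁ κ₂ (charModule (∅ : Set (PadicAlgCl 2)) θ) vbar
  obtain ⟨φ, hφ⟩ := LinePinControl.exists_transpose_unr hg hγ hprim hstab D₂ D₁
  haveI : Finite g.ker := finite_ker_lineRes_unr_charModule hγ θ hθ2 hθκ hg
  -- a presentation of the cokernel of control on the `γ₂`-invariants
  obtain ⟨N, hN⟩ : ∃ N : AddSubgroup ↥(endInvariants (conjSel₂ κ₁ κ₂ (charModule (∅ : Set (PadicAlgCl 2)) θ) vbar γ₂ - 1)),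
      ∀ s, s ∈ N ↔ (s : unrSelmer₂ κ₁ κ₂ (charModule (∅ : Set (PadicAlgCl 2)) θ) vbar) ∈ g.range :=
    ⟨g.range.comap (AddSubgroup.subtype _), fun s ↦ by rw [AddSubgroup.mem_comap, AddSubgroup.coe_subtype]⟩
  have hker : ∀ s : ↥(endInvariants (conjSel₂ κ₁ κ₂ (charModule (∅ : Set (PadicAlgCl 2)) θ) vbar γ₂ - 1)),
      QuotientAddGroup.mk' N s = 0 ↔ (s : unrSelmer₂ κ₁ κ₂ (charModule (∅ : Set (PadicAlgCl 2)) θ) vbar) ∈ g.range :=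
    fun s ↦ (QuotientAddGroup.eq_zero_iff s).trans (hN s)
  obtain ⟨htors, -, hab, h⟩ := zpCorank_eq_and_map_charIdeal_eq_span_of_powForm hg hφ hγ hcont hprim hκ₂ hvbar hI hτ hκτ hu hpu
    (QuotientAddGroup.mk' N) (QuotientAddGroup.mk'_surjective N) hker hD₁ hfin J G₂ F hF hQ G₁ hG₁ hM hA
  exact ⟨htors, hab, h⟩

/-- **FROBENIUS-ADAPTED FORM.** When the first generator `γ₁` itself lies in `D_v̄` (a Frobenius-adapted pair: `γ₁ ∈ Frob_v̄ · I_v̄` with `κ₂ γ₁ = 0`,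
available whenever `v̄` is undecomposed in the line — the natural normalisation for the analytic Euler factor `1 − a(1+T)^{−1} ∼ (1+T) − a`), the junction
needs no separate lift `τ`: take `τ := γ₁`. [cite: GreenbergVatsal2000, §2 Prop. (2.4)] [cite: deShalit1987, II.4.12] [cite: Mueller2020MCSplitTwo, Thm. 1.3] -/
theorem isTorsion_and_eq_and_map_charIdeal_eq_span_of_powForm_charModule_of_mem_decomp
    {vbar : HeightOneSpectrum (𝓞 K)} (hvbar : ((2 : ℕ) : 𝓞 K) ∈ vbar.asIdeal)
    {κ₁ κ₂ : ZpExtension K 2} (hκ₂ : κ₂.IsUnramifiedOutside vbar)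
    {γ₁ γ₂ : absoluteGaloisGroup K} (hγ : ZpExtension.IsTopGeneratorPair κ₁ κ₂ γ₁ γ₂) (hγ₁ : γ₁ ∈ decomp vbar)
    (θ : FramedGaloisRep K (padicCoeffIntegers (∅ : Set (PadicAlgCl 2))) 1) (hθ2 : ∀ σ : absoluteGaloisGroup K, θ σ ^ 2 = 1)
    (hθκ : ∃ σ ∈ κ₁.kerSubgroup, θ σ ≠ 1)
    (hI : ∀ y : absoluteGaloisGroup K, y ∈ ZpExtension.pairKer κ₁ κ₂ → y ∈ inertia vbar →
      ∀ m : charModule (∅ : Set (PadicAlgCl 2)) θ, y • m = m)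
    {u : ℤ} (hu : ∀ m : charModule (∅ : Set (PadicAlgCl 2)) θ, γ₁ • m = u • m) (hpu : (2 : ℤ) ∣ u - 1)
    (D₂ : DualData₂ κ₁ κ₂ (charModule (∅ : Set (PadicAlgCl 2)) θ) vbar γ₁ γ₂)
    (hfin : ∀ N : Submodule (IwasawaAlgebra₂ 2) D₂.X, Module.IsPseudoNull (IwasawaAlgebra₂ 2) N → Finite N)
    (D₁ : DatumDualData κ₁ γ₁ (charModule (∅ : Set (PadicAlgCl 2)) θ)
      (Castella2018.AcSelmer.bdpData (charModule (∅ : Set (PadicAlgCl 2)) θ) 2 vbar) ∅)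
    (hD₁ : Module.IsTorsion (IwasawaAlgebra 2) D₁.X)
    (J : ℤ_[2] →+* PadicComplexInt 2) (G₁ : PowerSeries (PadicComplexInt 2)) (hG₁ : G₁ ≠ 0)
    (hM : (charIdeal (IwasawaAlgebra 2) D₁.X).map (PowerSeries.map J) = Ideal.span {G₁})
    (G₂ : PowerSeries (PowerSeries (PadicComplexInt 2))) (F : IwasawaAlgebra₂ 2)
    (hF : charIdeal (IwasawaAlgebra₂ 2) D₂.X = Ideal.span {F})
    {a b : ℕ} (hQ : Ideal.span ({((2 : ℕ) : PowerSeries (PowerSeries (PadicComplexInt 2))) ^ a *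
        PowerSeries.map (PowerSeries.map J) F} : Set (PowerSeries (PowerSeries (PadicComplexInt 2)))) =
      Ideal.span {((2 : ℕ) : PowerSeries (PowerSeries (PadicComplexInt 2))) ^ b * G₂})
    {e : ℕ} (hA : Ideal.span ({PowerSeries.map (PowerSeries.constantCoeff (R := PadicComplexInt 2)) G₂} : Set (PowerSeries (PadicComplexInt 2))) =
      Ideal.span {((1 : PowerSeries (PadicComplexInt 2)) + PowerSeries.X) - (u : PowerSeries (PadicComplexInt 2))} ^ e *
        Ideal.span {G₁}) :
    Module.IsTorsion (IwasawaAlgebra₂ 2) D₂.X ∧ a = b ∧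
      (charIdeal (IwasawaAlgebra₂ 2) D₂.X).map (PowerSeries.map (PowerSeries.map J)) = Ideal.span {G₂} :=
  isTorsion_and_eq_and_map_charIdeal_eq_span_of_powForm_charModule hvbar hκ₂ hγ θ hθ2 hθκ hI hγ₁ rfl hu hpu D₂ hfin D₁ hD₁ J G₁ hG₁
    hM G₂ F hF hQ hA

end Junction

end Summit.BirchSwinnertonDyer.BirchSwinnertonDyer.Theorems.PrintCf2.LinePin

end
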